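import Literature.Barriers.AnomalousDissipation.OnsagerSingularityLeray
import Literature.Analysis.FluidPDE.LerayResolvedEnergy
import Literature.Analysis.FluidPDE.CoarseGrainingEstimates
import Literature.Analysis.FunctionSpaces.BesovSliceMeasurability
import Literature.Analysis.FluidPDE.LerayResolvedEnergyProofs
import HarnessLib

/-!
# Barrier (AnomalousDissipation): the Onsager singularity theorem for Leray solutions — proofs

Sorry-free companion of `Literature/Barriers/AnomalousDissipation/OnsagerSingularityLeray`
(Drivas–Eyink, *An Onsager singularity theorem for Leray solutions of incompressible
Navier–Stokes*, Nonlinearity 32 (2019) = arXiv:1710.05205, Lemma 1). It carries out the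
**assembly step of the printed proof of Lemma 1** (op. cit. §2, p. 9): the corrected barrier
statement `DrivasEyink2019_lemma1_measurable` is derived from the one analytic input the tree
records as a named fact, the global balance of resolved energy of Leray solutions
(`Literature.Analysis.FluidPDE.Torus.IsLerayHopfOn.resolvedEnergyBalance`, op. cit. Lemma 2,
`Literature/Analysis/FluidPDE/LerayResolvedEnergy`), and the fixed-time coarse-graining estimates
already proved in `Literature/Analysis/FluidPDE/CoarseGrainingEstimates`:

  `DrivasEyink2019_lemma1_measurable_of_resolvedEnergyBalance :
     (∀ d, Torus.IsLerayHopfOn.resolvedEnergyBalance (d := d)) → DrivasEyink2019_lemma1_measurable`.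

Lemma 2 of the source being discharged in the tree
(`Literature.Analysis.FluidPDE.Torus.IsLerayHopfOn.resolvedEnergyBalance_holds`,
`Literature/Analysis/FluidPDE/LerayResolvedEnergyProofs`, built on the distributional balance
`Torus.IsWeakNSSolutionForcedOn.resolvedEnergyBalance_distrib` of
`Literature/Analysis/FluidPDE/LerayResolvedEnergyDistributional`, the forced Navier–Stokes
analogue of the tree's Euler-case `Torus.energyBalance_vecConv_holds`), the barrier is
**discharged unconditionally**: `DrivasEyink2019_lemma1_measurable_holds` (end of this file).
(The original `DrivasEyink2019_lemma1` is mis-stated — see the Erratum in the statement file —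
and is not a target.)

## The printed argument, as formalised

From the resolved balance in inequality form
(`Torus.IsLerayHopfOn.dissipation_le_of_resolvedEnergyBalance`, the convexity step
`E(ū(T)) ≤ E(u(T))` being `Torus.kineticEnergy_vecConv_kernel_le`),
`ν∫₀ᵀ‖∇u‖₂² ≤ [E(u₀) - E(ū₀)] - ∫₀ᵀΠ_{k_ε} + ν∫₀ᵀ‖∇ū‖₂² + [∫₀ᵀ∫⟪f,u⟫ - ∫₀ᵀ∫⟪f̄,ū⟫]`,
the four terms are bounded in time-integrated form (op. cit. §2, (CETflux2), (viscEst),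
(Otherest1)–(Otherest2)):
* data cumulant `≤ d [u₀]²_{B^σ_2} ε^{2σ}` (fixed time, `CoarseGrainingEstimates`);
* flux `≤ 2d²C₁ ε^{3σ-1} ∫₀ᵀ[u]³_{B^σ_3} ≤ 2d²C₁ M₂³ ε^{3σ-1}` (`neg_integral_cetFlux_le`);
* resolved dissipation `≤ d²C₁² ε^{2σ-2} ∫₀ᵀ[u]²_{B^σ_2} ≤ d²C₁² (T + M₂³) ε^{2σ-2}`
  (`integral_gradNormSq_vecConv_le`; on the unit torus `[u]_{B^σ_2} ≤ [u]_{B^σ_3}` and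
  `[u]² ≤ 1 + [u]³`, which replaces the printed Hölder-in-time step and only changes the
  `ν`-independent constant);
* force cumulant `≤ 2d ε^{2σ} ∫₀ᵀ[f]_{B^σ_2}[u]_{B^σ_2} ≤ 2d M₁ (T + M₂³)^{1/2} ε^{2σ}` by
  Cauchy–Schwarz in time (`integral_inner_sub_integral_inner_vecConv_le`). This is the one place
  where measurability in time of the Besov seminorms is needed (a lower Lebesgue integral of a
  product of non-measurable functions does not factor); it is supplied by
  `Literature.Analysis.FunctionSpaces.aemeasurable_eBesovSupSeminorm_slice`
  (`FunctionSpaces/BesovSliceMeasurability`) from the joint measurability of `f` (the restored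
  hypothesis of the corrected statement) and of `u` (part of `Torus.IsWeakNSSolutionForcedOn`).
All time integrals of Besov quantities are lower Lebesgue integrals compared through
`lintegral_mono_ae` with the finiteness of `eLpBesovSupNorm`, as in
`Torus.lintegral_lintegral_enorm_pow_three_lt_top_of_memLpBesovSup`. Finally
(`DrivasEyink2019_lemma1_measurable_of_resolvedEnergyBalance`) the scale is tied to the
viscosity, `ε = ν^{1/(σ+1)}` for `ν ≤ ν₀ = (1/4)^{σ+1}` (so that `ε ≤ 1/4`, the tree's
mollifier range), giving `ε^{3σ-1} = ν ε^{2σ-2} = ν^{(3σ-1)/(σ+1)}` and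
`ε^{2σ} ≤ ε^{3σ-1}` (`σ ≤ 1`, `ε ≤ 1`): the printed "`O(ℓ^{3σ-1}) + O(νℓ^{2(σ-1)})`,
`ℓ ∼ ν^{1/(σ+1)}`".

## Mathlib search

Mathlib (this pin): Hölder for lower Lebesgue integrals (`ENNReal.lintegral_mul_le_Lp_mul_Lq`),
Fubini for Bochner integrals (`MeasureTheory.Integral.Prod`: `Integrable.integral_prod_left`),
real powers (`Real.rpow_*`); no Navier–Stokes or Besov content.

## References

* T. D. Drivas, G. L. Eyink, Nonlinearity 32 (2019) 4465–4482 = arXiv:1710.05205, §2, proof of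
  Lemma 1 (p. 9) and Lemma 2. [DrivasEyink2019]
* P. Constantin, W. E, E. S. Titi, Comm. Math. Phys. 165 (1994), 207–209. [ConstantinETiti1994]
-/

open MeasureTheory Set Filter Function
open _root_.Topology
open scoped ENNReal NNReal InnerProductSpace RealInnerProductSpace Convolution

noncomputable section

namespace Literature.Barriers.AnomalousDissipation

open Literature.Analysis Literature.Analysis.FluidPDE Literature.Analysis.FunctionSpaces

variable {d : Type*} [Fintype d]

/-! ## Elementary and time-integration helpers -/

/-- `x² ≤ 1 + x³` in `ℝ≥0∞` (by cases on `x ≤ 1`); used to dominate `[u]²_{B^σ}` by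
`1 + [u]³_{B^σ}` under the `L³_t` bound without Hölder in time. [folklore] -/
theorem ennreal_sq_le_one_add_cube (x : ℝ≥0∞) : x ^ 2 ≤ 1 + x ^ 3 := by
  rcases le_total x 1 with hx | hx
  · calc x ^ 2 ≤ 1 ^ 2 := by gcongr
      _ = 1 := one_pow 2
      _ ≤ 1 + x ^ 3 := le_self_add
  · calc x ^ 2 = x ^ 2 * 1 := (mul_one _).symm
      _ ≤ x ^ 2 * x := by gcongr
      _ = x ^ 3 := by ring
      _ ≤ 1 + x ^ 3 := le_add_self

/-- **Time-integrated cube of the Besov seminorm against the `L³_t B^s_{3,∞}` norm**: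
`∫_S [u(t)]³_{B^s_{3,∞}} dt ≤ ‖u‖³_{L³_t B^s_{3,∞}}` for `u ∈ L³_t B^s_{3,∞}` on `S` (lower
Lebesgue integral in time; the seminorm is dominated by the norm at a.e. time, where the latter is
finite, and `eLpBesovSupNorm` unfolds to `(∫_S ‖u(t)‖³)^{1/3}`). [folklore] -/
theorem lintegral_eBesovSupSeminorm_pow_three_le {G F' : Type*}
    [NormedAddCommGroup G] [MeasurableSpace G] [NormedAddCommGroup F'] {μ : Measure G} {s : ℝ} {S : Set ℝ}
    {u : ℝ → G → F'} (hB : MemLpBesovSup 3 s 3 u μ S) :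
    ∫⁻ t in S, eBesovSupSeminorm s 3 (u t) μ ^ 3 ≤ eLpBesovSupNorm 3 s 3 u μ S ^ 3 := by
  have h3r : ((3 : ℝ≥0∞)).toReal = 3 := by norm_num
  have heq : eLpBesovSupNorm 3 s 3 u μ S ^ 3 = ∫⁻ t in S, ‖(eBesovSupNorm s 3 (u t) μ).toReal‖ₑ ^ (3 : ℝ) := by
    rw [eLpBesovSupNorm, eLpNorm_eq_lintegral_rpow_enorm_toReal (by norm_num) (by norm_num), h3r,
      show ((∫⁻ t in S, ‖(eBesovSupNorm s 3 (u t) μ).toReal‖ₑ ^ (3 : ℝ)) ^ (1 / (3 : ℝ))) ^ 3 =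
        ((∫⁻ t in S, ‖(eBesovSupNorm s 3 (u t) μ).toReal‖ₑ ^ (3 : ℝ)) ^ (1 / (3 : ℝ))) ^ (3 : ℝ) by
          rw [show (3 : ℝ) = ((3 : ℕ) : ℝ) by norm_num, ENNReal.rpow_natCast],
      ← ENNReal.rpow_mul, show (1 / (3 : ℝ)) * 3 = 1 by norm_num, ENNReal.rpow_one]
  rw [heq]
  refine lintegral_mono_ae ?_
  filter_upwards [hB.1] with t ht
  have hfin : eBesovSupNorm s 3 (u t) μ ≠ ⊤ := ht.eBesovSupNorm_lt_top.ne
  rw [Real.enorm_eq_ofReal ENNReal.toReal_nonneg, ENNReal.ofReal_toReal hfin,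
    show (3 : ℝ) = ((3 : ℕ) : ℝ) by norm_num, ENNReal.rpow_natCast]
  gcongr
  exact le_add_self

/-- **Time-integrated square of the Besov seminorm against the `L²_t B^s_{2,∞}` norm**:
`∫_S [f(t)]²_{B^s_{2,∞}} dt ≤ ‖f‖²_{L²_t B^s_{2,∞}}` for `f ∈ L²_t B^s_{2,∞}` on `S`. [folklore] -/
theorem lintegral_eBesovSupSeminorm_sq_le {G F' : Type*}
    [NormedAddCommGroup G] [MeasurableSpace G] [NormedAddCommGroup F'] {μ : Measure G} {s : ℝ} {S : Set ℝ}
    {f : ℝ → G → F'} (hB : MemLpBesovSup 2 s 2 f μ S) :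
    ∫⁻ t in S, eBesovSupSeminorm s 2 (f t) μ ^ 2 ≤ eLpBesovSupNorm 2 s 2 f μ S ^ 2 := by
  have h2r : ((2 : ℝ≥0∞)).toReal = 2 := by norm_num
  have heq : eLpBesovSupNorm 2 s 2 f μ S ^ 2 = ∫⁻ t in S, ‖(eBesovSupNorm s 2 (f t) μ).toReal‖ₑ ^ (2 : ℝ) := by
    rw [eLpBesovSupNorm, eLpNorm_eq_lintegral_rpow_enorm_toReal (by norm_num) (by norm_num), h2r,
      show ((∫⁻ t in S, ‖(eBesovSupNorm s 2 (f t) μ).toReal‖ₑ ^ (2 : ℝ)) ^ (1 / (2 : ℝ))) ^ 2 =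
        ((∫⁻ t in S, ‖(eBesovSupNorm s 2 (f t) μ).toReal‖ₑ ^ (2 : ℝ)) ^ (1 / (2 : ℝ))) ^ (2 : ℝ) by
          rw [show (2 : ℝ) = ((2 : ℕ) : ℝ) by norm_num, ENNReal.rpow_natCast],
      ← ENNReal.rpow_mul, show (1 / (2 : ℝ)) * 2 = 1 by norm_num, ENNReal.rpow_one]
  rw [heq]
  refine lintegral_mono_ae ?_
  filter_upwards [hB.1] with t ht
  have hfin : eBesovSupNorm s 2 (f t) μ ≠ ⊤ := ht.eBesovSupNorm_lt_top.ne
  rw [Real.enorm_eq_ofReal ENNReal.toReal_nonneg, ENNReal.ofReal_toReal hfin,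
    show (2 : ℝ) = ((2 : ℕ) : ℝ) by norm_num, ENNReal.rpow_natCast]
  gcongr
  exact le_add_self

/-- **Besov seminorms increase with the integrability exponent on the unit torus**:
`[v]_{B^s_{2,∞}} ≤ [v]_{B^s_{3,∞}}` for a.e.-strongly measurable `v` (the torus is a
probability space, so `‖·‖_{L²} ≤ ‖·‖_{L³}` for each difference `v(· + h) - v`; Drivas–Eyink
2019, §2: "the nesting property `Lᵖ(T^d) ⊆ L^q(T^d)`, `p ≥ q`"). [folklore] -/
theorem eBesovSupSeminorm_two_le_three {F' : Type*} [NormedAddCommGroup F'] {s : ℝ}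
    {v : UnitAddTorus d → F'} (hv : AEStronglyMeasurable v volume) :
    eBesovSupSeminorm s 2 v volume ≤ eBesovSupSeminorm s 3 v volume := by
  refine iSup₂_mono fun h _ => ?_
  refine ENNReal.div_le_div_right ?_ _
  have hm : AEStronglyMeasurable (fun x => v (x + h) - v x) volume :=
    (hv.comp_quasiMeasurePreserving (measurePreserving_add_right volume h).quasiMeasurePreserving).sub hv
  exact eLpNorm_le_eLpNorm_of_exponent_le (by norm_num) hm

/-- `B^s_{3,∞}(T^d) ⊂ B^s_{2,∞}(T^d)` (unit torus, probability measure). [folklore] -/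
theorem memBesovSup_two_of_three {F' : Type*} [NormedAddCommGroup F'] {s : ℝ}
    {v : UnitAddTorus d → F'} (hv : MemBesovSup s 3 v volume) : MemBesovSup s 2 v volume :=
  ⟨hv.1.mono_exponent (by norm_num), (eBesovSupSeminorm_two_le_three hv.1.1).trans_lt hv.2⟩

/-- **`∫_S [u(t)]²_{B^s_{2,∞}} ≤ |S| + ‖u‖³_{L³_t B^s_{3,∞}}`** on the unit torus
(`[u]₂² ≤ [u]₃² ≤ 1 + [u]₃³` at a.e. time, then `lintegral_eBesovSupSeminorm_pow_three_le`). [folklore] -/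
theorem lintegral_eBesovSupSeminorm_two_sq_le {s : ℝ} {S : Set ℝ}
    {u : ℝ → UnitAddTorus d → EuclideanSpace ℝ d} (hB : MemLpBesovSup 3 s 3 u volume S) :
    ∫⁻ t in S, eBesovSupSeminorm s 2 (u t) volume ^ 2 ≤ volume S + eLpBesovSupNorm 3 s 3 u volume S ^ 3 := by
  calc ∫⁻ t in S, eBesovSupSeminorm s 2 (u t) volume ^ 2
      ≤ ∫⁻ t in S, (1 + eBesovSupSeminorm s 3 (u t) volume ^ 3) := by
        refine lintegral_mono_ae ?_
        filter_upwards [hB.1] with t ht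
        calc eBesovSupSeminorm s 2 (u t) volume ^ 2 ≤ eBesovSupSeminorm s 3 (u t) volume ^ 2 := by
              gcongr; exact eBesovSupSeminorm_two_le_three ht.1.1
          _ ≤ 1 + eBesovSupSeminorm s 3 (u t) volume ^ 3 := ennreal_sq_le_one_add_cube _
    _ = volume S + ∫⁻ t in S, eBesovSupSeminorm s 3 (u t) volume ^ 3 := by
        rw [lintegral_add_left measurable_const, setLIntegral_const, one_mul]
    _ ≤ volume S + eLpBesovSupNorm 3 s 3 u volume S ^ 3 := by
        gcongr; exact lintegral_eBesovSupSeminorm_pow_three_le hB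

/-- `(x²)^{1/2} = x` in `ℝ≥0∞`. [folklore] -/
theorem ennreal_sq_rpow_half (x : ℝ≥0∞) : (x ^ 2) ^ (1 / 2 : ℝ) = x := by
  rw [show x ^ 2 = x ^ (2 : ℝ) by rw [show (2 : ℝ) = ((2 : ℕ) : ℝ) by norm_num, ENNReal.rpow_natCast],
    ← ENNReal.rpow_mul, show (2 : ℝ) * (1 / 2) = 1 by norm_num, ENNReal.rpow_one]

/-! ## The four terms of the resolved balance, integrated in time -/

/-- **Time-integrated force cumulant bound** (Drivas–Eyink 2019, §2, proof of Lemma 1,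
(Otherest2): `∫₀ᵀ‖τ_ℓ(u; f)‖₁ dt ≤ C″_G ℓ^{2σ} sup‖f‖_{L²B^σ_2} sup‖u‖_{L³B^σ_3}`; here for
the difference of pairings `∫₀ᵀ∫⟪f,u⟫ - ∫₀ᵀ∫⟪f̄,ū⟫` that the tree's balance produces, with the
explicit constant `2d M₁ (T + M₂³)^{1/2} ε^{2σ}`): the fixed-time bound
`Torus.abs_integral_inner_sub_integral_inner_vecConv_le_of_memBesovSup` is integrated by
Cauchy–Schwarz in time, the two Besov factors being a.e.-measurable in time by
`Literature.Analysis.FunctionSpaces.aemeasurable_eBesovSupSeminorm_slice`, and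
`∫[f]² ≤ M₁²`, `∫[u]₂² ≤ T + M₂³`. [cite: DrivasEyink2019, §2, proof of Lemma 1, (Otherest2)] -/
theorem integral_inner_sub_integral_inner_vecConv_le {T σ ε : ℝ}
    {f u : ℝ → UnitAddTorus d → EuclideanSpace ℝ d} (hT : 0 < T) (hσ : 0 < σ) (hε : 0 < ε) (hε' : ε ≤ 1 / 4)
    (hfm : AEStronglyMeasurable (uncurry f) ((volume.restrict (Ioo 0 T)).prod volume))
    (hum : AEStronglyMeasurable (uncurry u) ((volume.restrict (Ioo 0 T)).prod volume))
    (hfB : MemLpBesovSup 2 σ 2 f volume (Ioo 0 T)) (huB : MemLpBesovSup 3 σ 3 u volume (Ioo 0 T))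
    (hIA : IntegrableOn (fun s => ∫ x, ⟪f s x, u s x⟫) (Ioo 0 T))
    (hIB : IntegrableOn (fun s => ∫ x, ⟪Torus.vecConv (f s) (FunctionSpaces.Torus.kernel ε) x,
      Torus.vecConv (u s) (FunctionSpaces.Torus.kernel ε) x⟫) (Ioo 0 T))
    {M₁ M₂ : ℝ≥0} (hM₁ : eLpBesovSupNorm 2 σ 2 f volume (Ioo 0 T) ≤ M₁)
    (hM₂ : eLpBesovSupNorm 3 σ 3 u volume (Ioo 0 T) ≤ M₂) :
    (∫ s in Ioo 0 T, ∫ x, ⟪f s x, u s x⟫) -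
        ∫ s in Ioo 0 T, ∫ x, ⟪Torus.vecConv (f s) (FunctionSpaces.Torus.kernel ε) x,
          Torus.vecConv (u s) (FunctionSpaces.Torus.kernel ε) x⟫ ≤
      2 * (Fintype.card d : ℝ) * (M₁ : ℝ) * Real.sqrt (T + (M₂ : ℝ) ^ 3) * ε ^ (2 * σ) := by
  set K : ℝ := 2 * (Fintype.card d : ℝ) with hK
  have hK0 : 0 ≤ K := by positivity
  have hKε : 0 ≤ K * ε ^ (2 * σ) := mul_nonneg hK0 (Real.rpow_nonneg hε.le _)
  set A : ℝ → ℝ := fun s => ∫ x, ⟪f s x, u s x⟫ with hA_def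
  set B : ℝ → ℝ := fun s => ∫ x, ⟪Torus.vecConv (f s) (FunctionSpaces.Torus.kernel ε) x,
      Torus.vecConv (u s) (FunctionSpaces.Torus.kernel ε) x⟫ with hB_def
  set F : ℝ → ℝ≥0∞ := fun s => eBesovSupSeminorm σ 2 (f s) volume with hF_def
  set U : ℝ → ℝ≥0∞ := fun s => eBesovSupSeminorm σ 2 (u s) volume with hU_def
  -- a.e. pointwise cumulant bound
  have hpt : ∀ᵐ s ∂(volume.restrict (Ioo 0 T)),
      ENNReal.ofReal ‖A s - B s‖ ≤ ENNReal.ofReal (K * ε ^ (2 * σ)) * (F s * U s) := by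
    filter_upwards [hfB.1, huB.1] with s hfs hus
    have hus2 : MemBesovSup σ 2 (u s) volume := memBesovSup_two_of_three hus
    have h := Torus.abs_integral_inner_sub_integral_inner_vecConv_le_of_memBesovSup hσ hfs hus2 hε hε'
    rw [Real.norm_eq_abs]
    calc ENNReal.ofReal |A s - B s|
        ≤ ENNReal.ofReal (K * ε ^ (2 * σ) * ((F s).toReal * (U s).toReal)) := by
          refine ENNReal.ofReal_le_ofReal (h.trans_eq ?_)
          rw [hK]; ring
      _ = ENNReal.ofReal (K * ε ^ (2 * σ)) * (F s * U s) := by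
          rw [ENNReal.ofReal_mul hKε, ENNReal.ofReal_mul ENNReal.toReal_nonneg,
            ENNReal.ofReal_toReal hfs.2.ne, ENNReal.ofReal_toReal hus2.2.ne]
  -- measurability of the two Besov factors in time
  have hFm : AEMeasurable F (volume.restrict (Ioo 0 T)) :=
    aemeasurable_eBesovSupSeminorm_slice one_le_two ENNReal.ofNat_ne_top hfm
      (hfB.1.mono fun t ht => ht.memLp)
  have hUm : AEMeasurable U (volume.restrict (Ioo 0 T)) :=
    aemeasurable_eBesovSupSeminorm_slice one_le_two ENNReal.ofNat_ne_top hum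
      (huB.1.mono fun t ht => ht.memLp.mono_exponent (by norm_num))
  -- Cauchy–Schwarz in time
  have hCS : ∫⁻ s in Ioo 0 T, F s * U s ≤ (M₁ : ℝ≥0∞) * (ENNReal.ofReal T + (M₂ : ℝ≥0∞) ^ 3) ^ (1 / 2 : ℝ) := by
    have h := ENNReal.lintegral_mul_le_Lp_mul_Lq (volume.restrict (Ioo 0 T)) Real.HolderConjugate.two_two hFm hUm
    have h2 : ∀ (G : ℝ → ℝ≥0∞), (∫⁻ s in Ioo 0 T, G s ^ (2 : ℝ)) = ∫⁻ s in Ioo 0 T, G s ^ 2 := fun G => by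
      refine lintegral_congr fun s => ?_
      rw [show (2 : ℝ) = ((2 : ℕ) : ℝ) by norm_num, ENNReal.rpow_natCast]
    rw [h2, h2] at h
    refine h.trans (mul_le_mul' ?_ ?_)
    · calc (∫⁻ s in Ioo 0 T, F s ^ 2) ^ (1 / 2 : ℝ) ≤ ((M₁ : ℝ≥0∞) ^ 2) ^ (1 / 2 : ℝ) := by
            gcongr
            exact (lintegral_eBesovSupSeminorm_sq_le hfB).trans (by gcongr)
        _ = M₁ := ennreal_sq_rpow_half _
    · gcongr
      refine (lintegral_eBesovSupSeminorm_two_sq_le huB).trans ?_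
      rw [Real.volume_Ioo, sub_zero]
      gcongr
  have hlin : ∫⁻ s in Ioo 0 T, ENNReal.ofReal ‖A s - B s‖ ≤
      ENNReal.ofReal (K * ε ^ (2 * σ)) * ((M₁ : ℝ≥0∞) * (ENNReal.ofReal T + (M₂ : ℝ≥0∞) ^ 3) ^ (1 / 2 : ℝ)) := by
    calc ∫⁻ s in Ioo 0 T, ENNReal.ofReal ‖A s - B s‖
        ≤ ∫⁻ s in Ioo 0 T, ENNReal.ofReal (K * ε ^ (2 * σ)) * (F s * U s) := lintegral_mono_ae hpt
      _ = ENNReal.ofReal (K * ε ^ (2 * σ)) * ∫⁻ s in Ioo 0 T, F s * U s :=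
          lintegral_const_mul' _ _ ENNReal.ofReal_ne_top
      _ ≤ _ := by gcongr
  have hsum_ne : ENNReal.ofReal T + (M₂ : ℝ≥0∞) ^ 3 ≠ ⊤ :=
    ENNReal.add_ne_top.2 ⟨ENNReal.ofReal_ne_top, ENNReal.pow_ne_top ENNReal.coe_ne_top⟩
  have hfinR : ENNReal.ofReal (K * ε ^ (2 * σ)) * ((M₁ : ℝ≥0∞) * (ENNReal.ofReal T + (M₂ : ℝ≥0∞) ^ 3) ^ (1 / 2 : ℝ)) ≠ ⊤ :=
    ENNReal.mul_ne_top ENNReal.ofReal_ne_top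
      (ENNReal.mul_ne_top ENNReal.coe_ne_top (ENNReal.rpow_ne_top_of_nonneg (by norm_num) hsum_ne))
  rw [← integral_sub hIA hIB]
  calc ∫ s in Ioo 0 T, (A s - B s) ≤ ‖∫ s in Ioo 0 T, (A s - B s)‖ := Real.le_norm_self _
    _ ≤ (∫⁻ s in Ioo 0 T, ENNReal.ofReal ‖A s - B s‖).toReal := norm_integral_le_lintegral_norm _
    _ ≤ (ENNReal.ofReal (K * ε ^ (2 * σ)) * ((M₁ : ℝ≥0∞) * (ENNReal.ofReal T + (M₂ : ℝ≥0∞) ^ 3) ^ (1 / 2 : ℝ))).toReal :=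
        ENNReal.toReal_mono hfinR hlin
    _ = K * (M₁ : ℝ) * Real.sqrt (T + (M₂ : ℝ) ^ 3) * ε ^ (2 * σ) := by
        rw [ENNReal.toReal_mul, ENNReal.toReal_ofReal hKε, ENNReal.toReal_mul, ENNReal.coe_toReal,
          ← ENNReal.toReal_rpow, ENNReal.toReal_add ENNReal.ofReal_ne_top (ENNReal.pow_ne_top ENNReal.coe_ne_top),
          ENNReal.toReal_ofReal hT.le, ENNReal.toReal_pow, ENNReal.coe_toReal, Real.sqrt_eq_rpow]
        ring


/-- **`L²_t B^{s}_{2,∞} ⊂ L²_{t,x}`**: a field of class `MemLpBesovSup 2 s 2` on the time set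
`S` has `∫_S∫‖f‖² < ∞` (the `p = 2` twin of
`Torus.lintegral_lintegral_enorm_pow_three_lt_top_of_memLpBesovSup`; supplies the force
hypothesis `f ∈ L²_{t,x}` of the resolved balance). [folklore] -/
theorem lintegral_lintegral_enorm_sq_lt_top_of_memLpBesovSup {G F' : Type*}
    [NormedAddCommGroup G] [MeasurableSpace G] [NormedAddCommGroup F'] {μ : Measure G} {s : ℝ} {S : Set ℝ}
    {f : ℝ → G → F'} (hB : MemLpBesovSup 2 s 2 f μ S) :
    ∫⁻ t in S, ∫⁻ x, ‖f t x‖ₑ ^ 2 ∂μ < ⊤ := by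
  have h2r : ((2 : ℝ≥0∞)).toReal = 2 := by norm_num
  have h2 : ∫⁻ t in S, ‖(eBesovSupNorm s 2 (f t) μ).toReal‖ₑ ^ (2 : ℝ) < ⊤ := by
    have := lintegral_rpow_enorm_lt_top_of_eLpNorm_lt_top (by norm_num) (by norm_num) hB.2
    rwa [h2r] at this
  refine lt_of_le_of_lt (lintegral_mono_ae ?_) h2
  filter_upwards [hB.1] with t ht
  have hfin : eBesovSupNorm s 2 (f t) μ ≠ ⊤ := ht.eBesovSupNorm_lt_top.ne
  have hpow : ∫⁻ x, ‖f t x‖ₑ ^ 2 ∂μ = eLpNorm (f t) 2 μ ^ (2 : ℝ) := by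
    have h := lintegral_rpow_enorm_eq_rpow_eLpNorm' (f := f t) (μ := μ) (q := 2)
      (by norm_num : (0 : ℝ) < 2)
    rw [eLpNorm_eq_eLpNorm' (by norm_num) (by norm_num), h2r, ← h]
    refine lintegral_congr fun x => ?_
    rw [show (2 : ℝ) = ((2 : ℕ) : ℝ) by norm_num, ENNReal.rpow_natCast]
  rw [hpow, Real.enorm_eq_ofReal ENNReal.toReal_nonneg, ENNReal.ofReal_toReal hfin]
  exact ENNReal.rpow_le_rpow le_self_add (by norm_num)

variable [DecidableEq d]

/-- **Time-integrated flux bound** (Drivas–Eyink 2019, §2, proof of Lemma 1, (CETflux2):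
`∫₀ᵀ‖Π_ℓ[u(t)]‖₁ dt ≤ C_G ℓ^{3σ-1} ∫₀ᵀ‖u(t)‖³_{B^σ_{3,∞}} dt = O(ℓ^{3σ-1})`): for
`u ∈ L³(0,T; B^σ_{3,∞})` weakly divergence free at a.e. time with `‖u‖_{L³B^σ_3} ≤ M₂`,
`-∫₀ᵀ Π_{k_ε}[u(s)] ds ≤ 2d²C₁ M₂³ ε^{3σ-1}` (the fixed-time
`Torus.abs_cetFlux_kernel_le_of_memBesovSup` under `lintegral_mono_ae`). [cite: DrivasEyink2019, §2, proof of Lemma 1, (CETflux2)] -/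
theorem neg_integral_cetFlux_le {T σ ε : ℝ} {u : ℝ → UnitAddTorus d → EuclideanSpace ℝ d}
    (hσ : 0 < σ) (hε : 0 < ε) (hε' : ε ≤ 1 / 4)
    (hB : MemLpBesovSup 3 σ 3 u volume (Ioo 0 T))
    (hdiv : ∀ᵐ s ∂(volume.restrict (Ioo 0 T)), FunctionSpaces.Torus.IsWeaklyDivFree (u s))
    {M₂ : ℝ≥0} (hM : eLpBesovSupNorm 3 σ 3 u volume (Ioo 0 T) ≤ M₂) :
    -(∫ s in Ioo 0 T, Torus.cetFlux (FunctionSpaces.Torus.kernel ε) (u s)) ≤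
      (Fintype.card d : ℝ) ^ 2 * (2 * FunctionSpaces.Torus.gradProfileMass d) * (M₂ : ℝ) ^ 3 * ε ^ (3 * σ - 1) := by
  set K : ℝ := (Fintype.card d : ℝ) ^ 2 * (2 * FunctionSpaces.Torus.gradProfileMass d) with hK
  have hK0 : 0 ≤ K := by
    have := FunctionSpaces.Torus.gradProfileMass_nonneg (d := d)
    positivity
  have hKε : 0 ≤ K * ε ^ (3 * σ - 1) := mul_nonneg hK0 (Real.rpow_nonneg hε.le _)
  have hpt : ∀ᵐ s ∂(volume.restrict (Ioo 0 T)),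
      ENNReal.ofReal ‖Torus.cetFlux (FunctionSpaces.Torus.kernel ε) (u s)‖ ≤
        ENNReal.ofReal (K * ε ^ (3 * σ - 1)) * eBesovSupSeminorm σ 3 (u s) volume ^ 3 := by
    filter_upwards [hB.1, hdiv] with s hs hds
    have h := Torus.abs_cetFlux_kernel_le_of_memBesovSup hσ hs hds hε hε'
    have hfin : eBesovSupSeminorm σ 3 (u s) volume ≠ ⊤ := hs.2.ne
    rw [Real.norm_eq_abs]
    calc ENNReal.ofReal |Torus.cetFlux (FunctionSpaces.Torus.kernel ε) (u s)|
        ≤ ENNReal.ofReal (K * ε ^ (3 * σ - 1) * (eBesovSupSeminorm σ 3 (u s) volume).toReal ^ 3) := by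
          refine ENNReal.ofReal_le_ofReal ?_
          calc |Torus.cetFlux (FunctionSpaces.Torus.kernel ε) (u s)|
              ≤ (Fintype.card d : ℝ) ^ 2 * (2 * FunctionSpaces.Torus.gradProfileMass d) *
                  (eBesovSupSeminorm σ 3 (u s) volume).toReal ^ 3 * ε ^ (3 * σ - 1) := h
            _ = K * ε ^ (3 * σ - 1) * (eBesovSupSeminorm σ 3 (u s) volume).toReal ^ 3 := by rw [hK]; ring
      _ = ENNReal.ofReal (K * ε ^ (3 * σ - 1)) * eBesovSupSeminorm σ 3 (u s) volume ^ 3 := by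
          rw [ENNReal.ofReal_mul hKε, ENNReal.ofReal_pow ENNReal.toReal_nonneg, ENNReal.ofReal_toReal hfin]
  have hI : ∫⁻ s in Ioo 0 T, ENNReal.ofReal ‖Torus.cetFlux (FunctionSpaces.Torus.kernel ε) (u s)‖ ≤
      ENNReal.ofReal (K * ε ^ (3 * σ - 1)) * (M₂ : ℝ≥0∞) ^ 3 := by
    calc ∫⁻ s in Ioo 0 T, ENNReal.ofReal ‖Torus.cetFlux (FunctionSpaces.Torus.kernel ε) (u s)‖
        ≤ ∫⁻ s in Ioo 0 T, ENNReal.ofReal (K * ε ^ (3 * σ - 1)) * eBesovSupSeminorm σ 3 (u s) volume ^ 3 :=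
          lintegral_mono_ae hpt
      _ = ENNReal.ofReal (K * ε ^ (3 * σ - 1)) * ∫⁻ s in Ioo 0 T, eBesovSupSeminorm σ 3 (u s) volume ^ 3 :=
          lintegral_const_mul' _ _ ENNReal.ofReal_ne_top
      _ ≤ ENNReal.ofReal (K * ε ^ (3 * σ - 1)) * (M₂ : ℝ≥0∞) ^ 3 := by
          gcongr
          exact (lintegral_eBesovSupSeminorm_pow_three_le hB).trans (by gcongr)
  have hfinR : ENNReal.ofReal (K * ε ^ (3 * σ - 1)) * (M₂ : ℝ≥0∞) ^ 3 ≠ ⊤ :=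
    ENNReal.mul_ne_top ENNReal.ofReal_ne_top (ENNReal.pow_ne_top ENNReal.coe_ne_top)
  calc -(∫ s in Ioo 0 T, Torus.cetFlux (FunctionSpaces.Torus.kernel ε) (u s))
      ≤ ‖∫ s in Ioo 0 T, Torus.cetFlux (FunctionSpaces.Torus.kernel ε) (u s)‖ := by
        rw [Real.norm_eq_abs]; exact neg_le_abs _
    _ ≤ (∫⁻ s in Ioo 0 T, ENNReal.ofReal ‖Torus.cetFlux (FunctionSpaces.Torus.kernel ε) (u s)‖).toReal :=
        norm_integral_le_lintegral_norm _
    _ ≤ (ENNReal.ofReal (K * ε ^ (3 * σ - 1)) * (M₂ : ℝ≥0∞) ^ 3).toReal := ENNReal.toReal_mono hfinR hI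
    _ = K * (M₂ : ℝ) ^ 3 * ε ^ (3 * σ - 1) := by
        rw [ENNReal.toReal_mul, ENNReal.toReal_ofReal hKε, ENNReal.toReal_pow, ENNReal.coe_toReal]
        ring

/-- **Time-integrated resolved dissipation bound** (Drivas–Eyink 2019, §2, proof of Lemma 1,
(viscEst): `∫₀ᵀ ν‖∇ū_ℓ‖₂² ≤ C'_G νℓ^{2(σ-1)} ∫₀ᵀ‖u‖²_{B^σ_{3,∞}} = O(νℓ^{2(σ-1)})`): for
`u ∈ L³(0,T; B^σ_{3,∞})` with `‖u‖_{L³B^σ_3} ≤ M₂`,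
`∫₀ᵀ ‖∇(u(s) ⋆ k_ε)‖₂² ds ≤ d²C₁² (T + M₂³) ε^{2σ-2}` (the fixed-time
`Torus.gradNormSq_vecConv_kernel_le_of_memBesovSup`, the nesting `[u]_{B^σ_2} ≤ [u]_{B^σ_3}`
of the unit torus and `[u]² ≤ 1 + [u]³` in place of the printed Hölder step, which only
changes the `ν`-independent constant). [cite: DrivasEyink2019, §2, proof of Lemma 1, (viscEst)] -/
theorem integral_gradNormSq_vecConv_le {T σ ε : ℝ} {u : ℝ → UnitAddTorus d → EuclideanSpace ℝ d}
    (hT : 0 < T) (hσ : 0 < σ) (hε : 0 < ε) (hε' : ε ≤ 1 / 4)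
    (hB : MemLpBesovSup 3 σ 3 u volume (Ioo 0 T))
    (hI : IntegrableOn (fun s => FunctionSpaces.Torus.gradNormSq (Torus.vecConv (u s) (FunctionSpaces.Torus.kernel ε))) (Ioo 0 T))
    {M₂ : ℝ≥0} (hM : eLpBesovSupNorm 3 σ 3 u volume (Ioo 0 T) ≤ M₂) :
    ∫ s in Ioo 0 T, FunctionSpaces.Torus.gradNormSq (Torus.vecConv (u s) (FunctionSpaces.Torus.kernel ε)) ≤
      (Fintype.card d : ℝ) ^ 2 * FunctionSpaces.Torus.gradProfileMass d ^ 2 * (T + (M₂ : ℝ) ^ 3) * ε ^ (2 * σ - 2) := by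
  set K : ℝ := (Fintype.card d : ℝ) ^ 2 * FunctionSpaces.Torus.gradProfileMass d ^ 2 with hK
  have hK0 : 0 ≤ K := by positivity
  have hKε : 0 ≤ K * ε ^ (2 * σ - 2) := mul_nonneg hK0 (Real.rpow_nonneg hε.le _)
  have hpt : ∀ᵐ s ∂(volume.restrict (Ioo 0 T)),
      ENNReal.ofReal (FunctionSpaces.Torus.gradNormSq (Torus.vecConv (u s) (FunctionSpaces.Torus.kernel ε))) ≤
        ENNReal.ofReal (K * ε ^ (2 * σ - 2)) * eBesovSupSeminorm σ 2 (u s) volume ^ 2 := by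
    filter_upwards [hB.1] with s hs
    have hs2 : MemBesovSup σ 2 (u s) volume := memBesovSup_two_of_three hs
    have hfin : eBesovSupSeminorm σ 2 (u s) volume ≠ ⊤ := hs2.2.ne
    have h := Torus.gradNormSq_vecConv_kernel_le_of_memBesovSup hσ hs2 hε hε'
    calc ENNReal.ofReal (FunctionSpaces.Torus.gradNormSq (Torus.vecConv (u s) (FunctionSpaces.Torus.kernel ε)))
        ≤ ENNReal.ofReal (K * ε ^ (2 * σ - 2) * (eBesovSupSeminorm σ 2 (u s) volume).toReal ^ 2) := by
          refine ENNReal.ofReal_le_ofReal (h.trans_eq ?_)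
          rw [hK]; ring
      _ = ENNReal.ofReal (K * ε ^ (2 * σ - 2)) * eBesovSupSeminorm σ 2 (u s) volume ^ 2 := by
          rw [ENNReal.ofReal_mul hKε, ENNReal.ofReal_pow ENNReal.toReal_nonneg, ENNReal.ofReal_toReal hfin]
  have hlin : ∫⁻ s in Ioo 0 T, ENNReal.ofReal (FunctionSpaces.Torus.gradNormSq (Torus.vecConv (u s) (FunctionSpaces.Torus.kernel ε))) ≤
      ENNReal.ofReal (K * ε ^ (2 * σ - 2)) * (ENNReal.ofReal T + (M₂ : ℝ≥0∞) ^ 3) := by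
    calc ∫⁻ s in Ioo 0 T, ENNReal.ofReal (FunctionSpaces.Torus.gradNormSq (Torus.vecConv (u s) (FunctionSpaces.Torus.kernel ε)))
        ≤ ∫⁻ s in Ioo 0 T, ENNReal.ofReal (K * ε ^ (2 * σ - 2)) * eBesovSupSeminorm σ 2 (u s) volume ^ 2 :=
          lintegral_mono_ae hpt
      _ = ENNReal.ofReal (K * ε ^ (2 * σ - 2)) * ∫⁻ s in Ioo 0 T, eBesovSupSeminorm σ 2 (u s) volume ^ 2 :=
          lintegral_const_mul' _ _ ENNReal.ofReal_ne_top
      _ ≤ ENNReal.ofReal (K * ε ^ (2 * σ - 2)) * (ENNReal.ofReal T + (M₂ : ℝ≥0∞) ^ 3) := by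
          gcongr
          refine (lintegral_eBesovSupSeminorm_two_sq_le hB).trans ?_
          rw [Real.volume_Ioo, sub_zero]
          gcongr
  have hfinR : ENNReal.ofReal (K * ε ^ (2 * σ - 2)) * (ENNReal.ofReal T + (M₂ : ℝ≥0∞) ^ 3) ≠ ⊤ :=
    ENNReal.mul_ne_top ENNReal.ofReal_ne_top
      (ENNReal.add_ne_top.2 ⟨ENNReal.ofReal_ne_top, ENNReal.pow_ne_top ENNReal.coe_ne_top⟩)
  have hnn : 0 ≤ᵐ[volume.restrict (Ioo 0 T)] fun s =>
      FunctionSpaces.Torus.gradNormSq (Torus.vecConv (u s) (FunctionSpaces.Torus.kernel ε)) :=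
    Eventually.of_forall fun s => FunctionSpaces.Torus.gradNormSq_nonneg _
  rw [integral_eq_lintegral_of_nonneg_ae hnn hI.1]
  calc (∫⁻ s in Ioo 0 T, ENNReal.ofReal (FunctionSpaces.Torus.gradNormSq (Torus.vecConv (u s) (FunctionSpaces.Torus.kernel ε)))).toReal
      ≤ (ENNReal.ofReal (K * ε ^ (2 * σ - 2)) * (ENNReal.ofReal T + (M₂ : ℝ≥0∞) ^ 3)).toReal :=
        ENNReal.toReal_mono hfinR hlin
    _ = K * (T + (M₂ : ℝ) ^ 3) * ε ^ (2 * σ - 2) := by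
        rw [ENNReal.toReal_mul, ENNReal.toReal_ofReal hKε, ENNReal.toReal_add ENNReal.ofReal_ne_top
          (ENNReal.pow_ne_top ENNReal.coe_ne_top), ENNReal.toReal_ofReal hT.le, ENNReal.toReal_pow,
          ENNReal.coe_toReal]
        ring

/-! ## Assembly -/

/-- **The dissipation bound at a fixed scale** (Drivas–Eyink 2019, §2, proof of Lemma 1, the
display (mainIneqFtermBND) `∫₀ᵀ∫ε = O(ℓ^{3σ-1}) + O(νℓ^{2(σ-1)})` before the choice of `ℓ`,
with explicit constants and the `O(ℓ^{2σ})` terms kept): under the resolved energy balance, for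
a Leray–Hopf solution on `T^d × [0,T]` with viscosity `ν > 0`, solenoidal measurable force
`f ∈ L²(0,T; B^σ_{2,∞})`, datum `u₀ ∈ B^σ_{2,∞}` and `u ∈ L³(0,T; B^σ_{3,∞})`, with norms at
most `M₁, M₀, M₂`, and every mollifier scale `0 < ε ≤ 1/4`,
`ν∫₀ᵀ‖∇u‖₂² ≤ dM₀²ε^{2σ} + 2d²C₁M₂³ε^{3σ-1} + ν d²C₁²(T+M₂³)ε^{2σ-2} + 2dM₁(T+M₂³)^{1/2}ε^{2σ}`
(`Torus.IsLerayHopfOn.dissipation_le_of_resolvedEnergyBalance` and the four time-integrated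
bounds above). [cite: DrivasEyink2019, §2, proof of Lemma 1] -/
theorem dissipation_le_of_scale (hA : Torus.IsLerayHopfOn.resolvedEnergyBalance (d := d))
    {T ν σ ε : ℝ} {f u : ℝ → UnitAddTorus d → EuclideanSpace ℝ d}
    {u₀ : UnitAddTorus d → EuclideanSpace ℝ d} (hT : 0 < T) (hσ : 0 < σ) (hν : 0 < ν)
    (hε : 0 < ε) (hε' : ε ≤ 1 / 4) (h : Torus.IsLerayHopfOn T ν f u₀ u)
    (hfdiv : ∀ t, FunctionSpaces.Torus.IsWeaklyDivFree (f t))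
    (hf_meas : AEStronglyMeasurable (FunctionSpaces.Torus.stLift f) (volume.restrict (Ioo 0 T ×ˢ univ)))
    (hdata_mem : MemBesovSup σ 2 u₀ volume) (hforce_mem : MemLpBesovSup 2 σ 2 f volume (Ioo 0 T))
    (hsol_mem : MemLpBesovSup 3 σ 3 u volume (Ioo 0 T)) {M₀ M₁ M₂ : ℝ≥0}
    (hM₀ : eBesovSupNorm σ 2 u₀ volume ≤ M₀) (hM₁ : eLpBesovSupNorm 2 σ 2 f volume (Ioo 0 T) ≤ M₁)
    (hM₂ : eLpBesovSupNorm 3 σ 3 u volume (Ioo 0 T) ≤ M₂) :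
    ν * (∫⁻ τ in Ioo 0 T, FunctionSpaces.Torus.eGradNormSq (u τ)).toReal ≤
      (Fintype.card d : ℝ) * (M₀ : ℝ) ^ 2 * ε ^ (2 * σ) +
        (Fintype.card d : ℝ) ^ 2 * (2 * FunctionSpaces.Torus.gradProfileMass d) * (M₂ : ℝ) ^ 3 * ε ^ (3 * σ - 1) +
        ν * ((Fintype.card d : ℝ) ^ 2 * FunctionSpaces.Torus.gradProfileMass d ^ 2 * (T + (M₂ : ℝ) ^ 3) * ε ^ (2 * σ - 2)) +
        2 * (Fintype.card d : ℝ) * (M₁ : ℝ) * Real.sqrt (T + (M₂ : ℝ) ^ 3) * ε ^ (2 * σ) := by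
  have hum : AEStronglyMeasurable (uncurry u) ((volume.restrict (Ioo 0 T)).prod volume) :=
    Torus.aestronglyMeasurable_uncurry_restrict_prod_of_stLift h.weak.1
  have hfm : AEStronglyMeasurable (uncurry f) ((volume.restrict (Ioo 0 T)).prod volume) :=
    Torus.aestronglyMeasurable_uncurry_restrict_prod_of_stLift hf_meas
  have hf2 : ∫⁻ t in Ioo 0 T, ∫⁻ x, ‖f t x‖ₑ ^ 2 < ⊤ :=
    lintegral_lintegral_enorm_sq_lt_top_of_memLpBesovSup hforce_mem
  have hu3 : ∫⁻ t in Ioo 0 T, ∫⁻ x, ‖u t x‖ₑ ^ 3 < ⊤ :=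
    Torus.lintegral_lintegral_enorm_pow_three_lt_top_of_memLpBesovSup hsol_mem
  have hu2 : ∫⁻ t in Ioo 0 T, ∫⁻ x, ‖u t x‖ₑ ^ 2 < ⊤ := h.weak.2.1
  have hu₀ : MemLp u₀ 2 volume := hdata_mem.1
  have hconv : FunctionSpaces.Torus.kineticEnergy (Torus.vecConv (u T) (FunctionSpaces.Torus.kernel ε)) ≤
      FunctionSpaces.Torus.kineticEnergy (u T) :=
    Torus.kineticEnergy_vecConv_kernel_le (h.memLp T ⟨hT.le, le_rfl⟩) hε hε'
  have main := Torus.IsLerayHopfOn.dissipation_le_of_resolvedEnergyBalance hA hν h hT hfdiv hf_meas hf2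
    hu₀ hu3 hε hε' hconv
  obtain ⟨-, hIg, hIB, -⟩ := hA hν h hfdiv hf_meas hf2 hu₀ hu3 hε hε'
  -- T1: data cumulant
  have hT1 : FunctionSpaces.Torus.kineticEnergy u₀ -
      FunctionSpaces.Torus.kineticEnergy (Torus.vecConv u₀ (FunctionSpaces.Torus.kernel ε)) ≤
      (Fintype.card d : ℝ) * (M₀ : ℝ) ^ 2 * ε ^ (2 * σ) := by
    have h1 := Torus.abs_kineticEnergy_sub_kineticEnergy_vecConv_le_of_memBesovSup hσ hdata_mem hε hε'
    have hle : (eBesovSupSeminorm σ 2 u₀ volume).toReal ≤ M₀ := by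
      have h' : eBesovSupSeminorm σ 2 u₀ volume ≤ (M₀ : ℝ≥0∞) := le_add_self.trans hM₀
      have := ENNReal.toReal_mono ENNReal.coe_ne_top h'
      rwa [ENNReal.coe_toReal] at this
    have hd : (0 : ℝ) ≤ Fintype.card d := Nat.cast_nonneg _
    have hεp : 0 ≤ ε ^ (2 * σ) := Real.rpow_nonneg hε.le _
    calc _ ≤ |FunctionSpaces.Torus.kineticEnergy u₀ -
          FunctionSpaces.Torus.kineticEnergy (Torus.vecConv u₀ (FunctionSpaces.Torus.kernel ε))| := le_abs_self _
      _ ≤ (Fintype.card d : ℝ) * (eBesovSupSeminorm σ 2 u₀ volume).toReal ^ 2 * ε ^ (2 * σ) := h1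
      _ ≤ (Fintype.card d : ℝ) * (M₀ : ℝ) ^ 2 * ε ^ (2 * σ) := by
          gcongr
  -- T2: flux
  have hT2 := neg_integral_cetFlux_le hσ hε hε' hsol_mem h.weak.2.2.1 hM₂
  -- T3: resolved dissipation
  have hT3 := integral_gradNormSq_vecConv_le hT hσ hε hε' hsol_mem hIg hM₂
  have hT3' := mul_le_mul_of_nonneg_left hT3 hν.le
  -- T4: force cumulant
  have hIA : IntegrableOn (fun s => ∫ x, ⟪f s x, u s x⟫) (Ioo 0 T) :=
    Torus.integrableOn_integral_inner_of_sq hfm hum hf2 hu2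
  have hint : (∫ τ in (0 : ℝ)..T, ∫ x, ⟪f τ x, u τ x⟫) = ∫ s in Ioo 0 T, ∫ x, ⟪f s x, u s x⟫ := by
    rw [intervalIntegral.integral_of_le hT.le, integral_Ioc_eq_integral_Ioo]
  have hT4 := integral_inner_sub_integral_inner_vecConv_le hT hσ hε hε' hfm hum hforce_mem hsol_mem hIA hIB hM₁ hM₂
  rw [hint] at main
  linarith

/-- **The Drivas–Eyink Onsager singularity theorem (corrected statement) from the resolved
energy balance** (Drivas–Eyink 2019, Lemma 1, proof in §2 p. 9): the named fact
`Torus.IsLerayHopfOn.resolvedEnergyBalance` (op. cit. Lemma 2), assumed in every dimension type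
`d`, implies `DrivasEyink2019_lemma1_measurable` — with `ν₀ = (1/4)^{σ+1}`, the scale
`ε = ν^{1/(σ+1)} ≤ 1/4` in `dissipation_le_of_scale`, `ε^{3σ-1} = νε^{2σ-2} = ν^{(3σ-1)/(σ+1)}`
and `ε^{2σ} ≤ ε^{3σ-1}` (`σ ≤ 1`), and the `ν`-independent constant
`C = dM₀² + 2d²C₁M₂³ + d²C₁²(T+M₂³) + 2dM₁(T+M₂³)^{1/2}`. The discharge of the barrier is
thereby reduced to that of Lemma 2. [cite: DrivasEyink2019, Lemma 1 and §2, proof of Lemma 1] -/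
theorem DrivasEyink2019_lemma1_measurable_of_resolvedEnergyBalance
    (hA : ∀ (d : Type) [Fintype d] [DecidableEq d], Torus.IsLerayHopfOn.resolvedEnergyBalance (d := d)) :
    DrivasEyink2019_lemma1_measurable := by
  intro d _ _ T hT σ hσ ν hν f u₀ u hLeray hf_div hf_meas hdata_mem hdata hforce_mem hforce hsol_mem hsol
  obtain ⟨M₀, hM₀⟩ := hdata
  obtain ⟨M₁, hM₁⟩ := hforce
  obtain ⟨M₂, hM₂⟩ := hsol
  set C₁ : ℝ := FunctionSpaces.Torus.gradProfileMass d with hC₁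
  set a : ℝ := (Fintype.card d : ℝ) * (M₀ : ℝ) ^ 2 with ha
  set b : ℝ := (Fintype.card d : ℝ) ^ 2 * (2 * C₁) * (M₂ : ℝ) ^ 3 with hb
  set c : ℝ := (Fintype.card d : ℝ) ^ 2 * C₁ ^ 2 * (T + (M₂ : ℝ) ^ 3) with hc
  set e : ℝ := 2 * (Fintype.card d : ℝ) * (M₁ : ℝ) * Real.sqrt (T + (M₂ : ℝ) ^ 3) with he
  have hC₁0 : 0 ≤ C₁ := FunctionSpaces.Torus.gradProfileMass_nonneg (d := d)
  have ha0 : 0 ≤ a := by positivity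
  have hb0 : 0 ≤ b := by positivity
  have he0 : 0 ≤ e := by positivity
  refine ⟨(1 / 4 : ℝ) ^ (σ + 1), by positivity, a + b + c + e, fun j hj => ?_⟩
  set p : ℝ := (3 * σ - 1) / (σ + 1) with hp
  have hσ1 : 0 < σ + 1 := by linarith [hσ.1]
  set ε : ℝ := ν j ^ (1 / (σ + 1)) with hε_def
  have hε : 0 < ε := Real.rpow_pos_of_pos (hν j) _
  have hε' : ε ≤ 1 / 4 := by
    calc ε ≤ ((1 / 4 : ℝ) ^ (σ + 1)) ^ (1 / (σ + 1)) :=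
          Real.rpow_le_rpow (hν j).le hj (by positivity)
      _ = 1 / 4 := by
          rw [← Real.rpow_mul (by norm_num), mul_one_div_cancel hσ1.ne', Real.rpow_one]
  have hε1 : ε ≤ 1 := hε'.trans (by norm_num)
  have key := dissipation_le_of_scale (hA d) hT hσ.1 (hν j) hε hε' (hLeray j) (hf_div j) (hf_meas j)
    (hdata_mem j) (hforce_mem j) (hsol_mem j) (hM₀ j) (hM₁ j) (hM₂ j)
  -- exponent bookkeeping
  have e1 : ε ^ (3 * σ - 1) = ν j ^ p := by
    rw [hε_def, ← Real.rpow_mul (hν j).le]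
    congr 1
    rw [hp]; field_simp
  have e2 : ν j * ε ^ (2 * σ - 2) = ν j ^ p := by
    rw [hε_def, ← Real.rpow_mul (hν j).le]
    conv_lhs => rw [show ν j * ν j ^ (1 / (σ + 1) * (2 * σ - 2)) = ν j ^ (1 : ℝ) * ν j ^ (1 / (σ + 1) * (2 * σ - 2)) by
      rw [Real.rpow_one]]
    rw [← Real.rpow_add (hν j)]
    congr 1
    rw [hp]; field_simp; ring
  have e3 : ε ^ (2 * σ) ≤ ε ^ (3 * σ - 1) :=
    Real.rpow_le_rpow_of_exponent_ge hε hε1 (by linarith [hσ.2])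
  have hνp : 0 ≤ ν j ^ p := Real.rpow_nonneg (hν j).le _
  have i1 : a * ε ^ (2 * σ) ≤ a * ν j ^ p := mul_le_mul_of_nonneg_left (e3.trans_eq e1) ha0
  have i2 : b * ε ^ (3 * σ - 1) = b * ν j ^ p := by rw [e1]
  have i3 : ν j * (c * ε ^ (2 * σ - 2)) = c * ν j ^ p := by rw [← e2]; ring
  have i4 : e * ε ^ (2 * σ) ≤ e * ν j ^ p := mul_le_mul_of_nonneg_left (e3.trans_eq e1) he0
  calc ν j * (∫⁻ τ in Ioo 0 T, FunctionSpaces.Torus.eGradNormSq (u j τ)).toReal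
      ≤ a * ε ^ (2 * σ) + b * ε ^ (3 * σ - 1) + ν j * (c * ε ^ (2 * σ - 2)) + e * ε ^ (2 * σ) := key
    _ ≤ a * ν j ^ p + b * ν j ^ p + c * ν j ^ p + e * ν j ^ p := by linarith
    _ = (a + b + c + e) * ν j ^ p := by ring

/-! ## The discharge -/

/-- **Discharge of the barrier `DrivasEyink2019_lemma1_measurable`** (Drivas–Eyink 2019,
Lemma 1 — the Onsager singularity theorem for Leray solutions in quantitative form, corrected
measurable-data statement): unconditional, by `DrivasEyink2019_lemma1_measurable_of_resolvedEnergyBalance`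
and the discharge `Torus.IsLerayHopfOn.resolvedEnergyBalance_holds` of Lemma 2 of the source
(`Literature/Analysis/FluidPDE/LerayResolvedEnergyProofs`). [cite: DrivasEyink2019, Lemma 1] -/
theorem DrivasEyink2019_lemma1_measurable_holds : DrivasEyink2019_lemma1_measurable :=
  DrivasEyink2019_lemma1_measurable_of_resolvedEnergyBalance fun d _ _ =>
    Torus.IsLerayHopfOn.resolvedEnergyBalance_holds (d := d)

/-- **The barrier in `ε`-form, unconditional**: for Leray–Hopf solutions on `T^d × [0,T]` with
measurable solenoidal forces and Besov data, uniformly bounded in `L³(0,T; B^σ_{3,∞})` for some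
`σ > 1/3` (data and forces uniformly in `B^σ_{2,∞}`), the viscous dissipation on `[0,T]` tends to
`0` along any `ν_j → 0`: no anomalous dissipation without Onsager-type quasi-singularities
(Drivas–Eyink 2019, Thm. 1 with `α = 0`). [cite: DrivasEyink2019, Thm. 1] -/
theorem DrivasEyink2019_noAnomalousDissipation
    (d : Type) [Fintype d] [DecidableEq d] (T : ℝ) (hT : 0 < T) (σ : ℝ) (hσ : 1 / 3 < σ ∧ σ ≤ 1)
    (ν : ℕ → ℝ) (hν : ∀ j, 0 < ν j) (hν₀ : Tendsto ν atTop (𝓝 0))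
    (f : ℕ → ℝ → UnitAddTorus d → EuclideanSpace ℝ d)
    (u₀ : ℕ → UnitAddTorus d → EuclideanSpace ℝ d)
    (u : ℕ → ℝ → UnitAddTorus d → EuclideanSpace ℝ d)
    (hLeray : ∀ j, Literature.Analysis.FluidPDE.Torus.IsLerayHopfOn T (ν j) (f j) (u₀ j) (u j))
    (hf_div : ∀ j t, Literature.Analysis.FunctionSpaces.Torus.IsWeaklyDivFree (f j t))
    (hf_meas : ∀ j, AEStronglyMeasurable (Literature.Analysis.FunctionSpaces.Torus.stLift (f j))
      (volume.restrict (Ioo 0 T ×ˢ univ)))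
    (hdata_mem : ∀ j, Literature.Analysis.FunctionSpaces.MemBesovSup σ 2 (u₀ j) volume)
    (hdata : ∃ M₀ : ℝ≥0, ∀ j, Literature.Analysis.FunctionSpaces.eBesovSupNorm σ 2 (u₀ j) volume ≤ M₀)
    (hforce_mem : ∀ j, Literature.Analysis.FunctionSpaces.MemLpBesovSup 2 σ 2 (f j) volume (Ioo 0 T))
    (hforce : ∃ M₁ : ℝ≥0, ∀ j, Literature.Analysis.FunctionSpaces.eLpBesovSupNorm 2 σ 2 (f j) volume (Ioo 0 T) ≤ M₁)
    (hsol_mem : ∀ j, Literature.Analysis.FunctionSpaces.MemLpBesovSup 3 σ 3 (u j) volume (Ioo 0 T))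
    (hsol : ∃ M₂ : ℝ≥0, ∀ j, Literature.Analysis.FunctionSpaces.eLpBesovSupNorm 3 σ 3 (u j) volume (Ioo 0 T) ≤ M₂) :
    Tendsto (fun j => ν j * (∫⁻ τ in Ioo 0 T, Literature.Analysis.FunctionSpaces.Torus.eGradNormSq (u j τ)).toReal)
      atTop (𝓝 0) :=
  DrivasEyink2019_lemma1_measurable_holds.noAnomalousDissipation d T hT σ hσ ν hν hν₀ f u₀ u hLeray hf_div
    hf_meas hdata_mem hdata hforce_mem hforce hsol_mem hsol

end Literature.Barriers.AnomalousDissipation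

end
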